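import Mathlib
import HarnessLib
import Summits.HubbardSuperconductivity.HubbardSuperconductivity.Theorems.KLProgrammePerturbedFermiCurveTowerSixDefs
import Summits.HubbardSuperconductivity.HubbardSuperconductivity.Theorems.KLProgrammePerturbedFermiCurveTowerSixStep

/-!
# Route `KLProgramme` — the frame's curve tower at ORDERS 5 and 6: `|u_K⁽⁵⁾| ≤ klCurveT5`, `|u_K⁽⁶⁾| ≤ klCurveT6`,
# `‖∂⁵_ϑ toLp(k_F^K)‖ ≤ klCurveD5`, `‖∂⁶_ϑ toLp(k_F^K)‖ ≤ klCurveD6`; packaged: `‖∂ⁱ_ϑ toLp(k_F^K)‖ ≤ msD6 A₃ A₄ A₅ A₆ i` (`1 ≤ i ≤ 6`)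

Cell `gate-hubbard-kl`, seat hubbard-kl-k3c3-p3 (g18; row «implicit-function / monotonicity route»).  Located brick «(T)-TOWER-56» for the
(C)-closer lane (stub (C) `stub_twoLeg_curvature` of `KLRegimeEngineV17F2`, stmt-HubbardSuperconductivity-20437; c4a-1 C4A-PLAN §24.9:
«orders 3–4 at (T) wait for tables msD 5,6 / K₅,K₆»).  The hypotheses are EXACTLY those of `…TowerOfSizes.fermiPointLp_sizes_of_sizes`
(`‖Dʲ frameShift K‖ ≤ A` for `j ≤ 2`, `A ≤ 1/20`, `klCurveD ≤ Dt_min − 2A`, window margins `−1.1 ≤ ν − A`, `ν + A ≤ −0.1`, sizes `A₃, A₄`)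
plus the order-5/6 sizes `‖D⁵ frameShift K‖ ≤ A₅`, `‖D⁶ frameShift K‖ ≤ A₆` (on `Momentum`).  Orders `≤ 4` are the landed
`frameRadius_tower_of_sizes` / `fermiPointLp_sizes_of_sizes`; orders 5, 6 are the frame step `…TowerSixStep.abs_iteratedDeriv_frameRadius_le_step`
(generic level tower, Faà di Bruno along the curve) with `F = msD A₃ A₄` (resp. `msD6`), `G = klCurveG5` (resp. `klCurveG6`),
`E_max = 4 + 1/20 + A₃ + A₄ + A₅ (+ A₆)`.

* `abs_iteratedDeriv_frameRadius_le_table` (orders `≤ 4` in the `iteratedDeriv` key), `norm_iteratedDeriv_fermiPointLp_le_msD`, `msD_le_klCurveG5_pow`;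
* **`abs_iteratedDeriv_five_frameRadius_le`** (`|u_K⁽⁵⁾(θ)| ≤ klCurveT5 A₃ A₄ A₅`), **`norm_iteratedDeriv_five_fermiPointLp_le`** (`≤ klCurveD5 A₃ A₄ A₅`);
* **`abs_iteratedDeriv_six_frameRadius_le`** (`≤ klCurveT6 A₃ A₄ A₅ A₆`), **`norm_iteratedDeriv_six_fermiPointLp_le`** (`≤ klCurveD6 A₃ A₄ A₅ A₆`);
* **`norm_iteratedDeriv_fermiPointLp_le_msD6`**, **`fermiPointLp_sizes_of_sizes_six`** (`γ_K ∈ C⁶`, `‖Dⁱγ_K‖ ≤ msD6 … i`, `1 ≤ i ≤ 6`).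

Everything is PROVED; no definitions; nothing about the Hubbard model's sizes; nothing asserts superconductivity.
References: BGM 2006 §2.4 Lemma 2.1 (2.40) [cite: BenfattoGiulianiMastropietro2006]; FST II CPAM 51 (1998) §3.
-/

noncomputable section

namespace Summit.HubbardSuperconductivity.HubbardSuperconductivity.Theorems.PerturbedFermiCurve

set_option linter.dupNamespace false -- summit = problem name (single-conjunct summit), D-0017

open Real Set Finset
open Literature.MathematicalPhysics.QuantumLattice Literature.MathematicalPhysics.QuantumLattice.BandSectorCounting
open Summit.HubbardSuperconductivity.HubbardSuperconductivity.Theorems.DispersionFlow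
open Summit.HubbardSuperconductivity.HubbardSuperconductivity.Theorems.KLRegimeSplit

section Sizes

variable {K : TrigPolyC4v} {A : ℝ} (hA : ∀ p : Momentum, ∀ j ≤ 2, ‖iteratedFDeriv ℝ j (frameShift K) p‖ ≤ A) (hA20 : A ≤ 1 / 20)
  (hd : klCurveD ≤ (bandBounds (show (-4 : ℝ) < -1.1 by norm_num) (show (-1.1 : ℝ) ≤ -0.1 by norm_num)
    (show (-0.1 : ℝ) < 0 by norm_num)).Dtmin - 2 * A)
  {ν : ℝ} (hlo : (-1.1 : ℝ) ≤ ν - A) (hhi : ν + A ≤ -0.1)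
include hA hA20 hd hlo hhi

/-! ## Orders 5 and 6 -/

variable {A₃ A₄ A₅ A₆ : ℝ} (hA₃ : ∀ p : Momentum, ‖iteratedFDeriv ℝ 3 (frameShift K) p‖ ≤ A₃)
  (hA₄ : ∀ p : Momentum, ‖iteratedFDeriv ℝ 4 (frameShift K) p‖ ≤ A₄)
  (hA₅ : ∀ p : Momentum, ‖iteratedFDeriv ℝ 5 (frameShift K) p‖ ≤ A₅)
  (hA₆ : ∀ p : Momentum, ‖iteratedFDeriv ℝ 6 (frameShift K) p‖ ≤ A₆)
include hA₃ hA₄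

/-- The landed orders `≤ 4` in the `iteratedDeriv` key, against ANY table `R` with `R 0 = π√2`, `R 1 = R1`, `R 2 = R2`, `R 3 = T3(A₃)`,
`R 4 = T4(A₃,A₄)`: `|u⁽ⁱ⁾(θ)| ≤ R i` for `i ≤ 4`. -/
theorem abs_iteratedDeriv_frameRadius_le_table (θ : ℝ) {R : ℕ → ℝ} (h0 : R 0 = π * Real.sqrt 2) (h1 : R 1 = klCurveR1)
    (h2 : R 2 = klCurveR2) (h3 : R 3 = klCurveT3 A₃) (h4 : R 4 = klCurveT4 A₃ A₄) {i : ℕ} (hi : i ≤ 4) :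
    |iteratedDeriv i (perturbedFermiRadius (fun p : Fin 2 → ℝ => -K.eval p) ν) θ| ≤ R i := by
  obtain ⟨g0, g1, g2, g3, g4⟩ := frameRadius_tower_of_sizes hA hA20 hd hlo hhi hA₃ hA₄ θ
  interval_cases i
  · rw [h0]; simpa using g0
  · rw [h1]; simpa [iteratedDeriv_one] using g1
  · rw [h2, iteratedDeriv_eq_iterate]; exact g2
  · rw [h3, iteratedDeriv_eq_iterate]; exact g3
  · rw [h4, iteratedDeriv_eq_iterate]; exact g4

/-- The landed curve sizes `‖γ⁽ⁱ⁾‖ ≤ msD A₃ A₄ i` (`1 ≤ i ≤ 4`) in the `iteratedDeriv` key. -/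
theorem norm_iteratedDeriv_fermiPointLp_le_msD (θ : ℝ) {i : ℕ} (hi1 : 1 ≤ i) (hi4 : i ≤ 4) :
    ‖iteratedDeriv i (fun t : ℝ => (WithLp.toLp 2 (klFermiPoint ν K t) : Momentum)) θ‖ ≤ msD A₃ A₄ i := by
  obtain ⟨-, d1, d2, d3, d4⟩ := fermiPointLp_sizes_of_sizes hA hA20 hd hlo hhi hA₃ hA₄ θ
  rw [← norm_iteratedFDeriv_eq_norm_iteratedDeriv]
  interval_cases i
  · exact d1
  · exact d2
  · exact d3
  · exact d4

/-- `msD A₃ A₄ i ≤ klCurveG5ⁱ` (`1 ≤ i ≤ 4`): the geometric scale dominates every lower curve size. -/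
theorem msD_le_klCurveG5_pow (θ : ℝ) {i : ℕ} (hi1 : 1 ≤ i) (hi4 : i ≤ 4) : msD A₃ A₄ i ≤ klCurveG5 A₃ A₄ ^ i := by
  have hnn : ∀ j, 1 ≤ j → j ≤ 4 → 0 ≤ msD A₃ A₄ j :=
    fun j hj1 hj4 => (norm_nonneg _).trans (norm_iteratedDeriv_fermiPointLp_le_msD hA hA20 hd hlo hhi hA₃ hA₄ θ hj1 hj4)
  have h1 : 0 ≤ klCurveD1 := hnn 1 le_rfl (by norm_num)
  have h2 : 0 ≤ klCurveD2 := hnn 2 (by norm_num) (by norm_num)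
  have h3 : 0 ≤ klCurveD3 A₃ := hnn 3 (by norm_num) (by norm_num)
  have h4 : 0 ≤ klCurveD4 A₃ A₄ := hnn 4 (by norm_num) le_rfl
  have hG1 : klCurveD1 ≤ klCurveG5 A₃ A₄ := by unfold klCurveG5; exact le_trans (le_trans (le_max_left _ _) (le_max_left _ _)) (le_max_left _ _)
  have hG2 : klCurveD2 ^ ((2 : ℝ)⁻¹) ≤ klCurveG5 A₃ A₄ := by
    unfold klCurveG5; exact le_trans (le_trans (le_max_right _ _) (le_max_left _ _)) (le_max_left _ _)
  have hG3 : klCurveD3 A₃ ^ ((3 : ℝ)⁻¹) ≤ klCurveG5 A₃ A₄ := by unfold klCurveG5; exact le_trans (le_max_right _ _) (le_max_left _ _)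
  have hG4 : klCurveD4 A₃ A₄ ^ ((4 : ℝ)⁻¹) ≤ klCurveG5 A₃ A₄ := by unfold klCurveG5; exact le_max_right _ _
  interval_cases i
  · simpa [msD] using hG1
  · have hr : (klCurveD2 ^ ((2 : ℝ)⁻¹)) ^ 2 = klCurveD2 := by
      have := Real.rpow_inv_natCast_pow h2 (n := 2) two_ne_zero; simp only [Nat.cast_ofNat] at this; exact this
    calc msD A₃ A₄ 2 = (klCurveD2 ^ ((2 : ℝ)⁻¹)) ^ 2 := by simp [msD, hr]
      _ ≤ klCurveG5 A₃ A₄ ^ 2 := pow_le_pow_left₀ (by positivity) hG2 2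
  · have hr : (klCurveD3 A₃ ^ ((3 : ℝ)⁻¹)) ^ 3 = klCurveD3 A₃ := by
      have := Real.rpow_inv_natCast_pow h3 (n := 3) (by norm_num); simp only [Nat.cast_ofNat] at this; exact this
    calc msD A₃ A₄ 3 = (klCurveD3 A₃ ^ ((3 : ℝ)⁻¹)) ^ 3 := by simp [msD, hr]
      _ ≤ klCurveG5 A₃ A₄ ^ 3 := pow_le_pow_left₀ (by positivity) hG3 3
  · have hr : (klCurveD4 A₃ A₄ ^ ((4 : ℝ)⁻¹)) ^ 4 = klCurveD4 A₃ A₄ := by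
      have := Real.rpow_inv_natCast_pow h4 (n := 4) (by norm_num); simp only [Nat.cast_ofNat] at this; exact this
    calc msD A₃ A₄ 4 = (klCurveD4 A₃ A₄ ^ ((4 : ℝ)⁻¹)) ^ 4 := by simp [msD, hr]
      _ ≤ klCurveG5 A₃ A₄ ^ 4 := pow_le_pow_left₀ (by positivity) hG4 4

include hA₅

/-- **ORDER 5 of the frame's Fermi radius**: `|u_K⁽⁵⁾(θ)| ≤ klCurveT5 A₃ A₄ A₅` at every angle, every level `ν` with the window margins.
[cite: BenfattoGiulianiMastropietro2006, §2.4 Lemma 2.1 (2.40)] -/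
theorem abs_iteratedDeriv_five_frameRadius_le (θ : ℝ) :
    |iteratedDeriv 5 (perturbedFermiRadius (fun p : Fin 2 → ℝ => -K.eval p) ν) θ| ≤ klCurveT5 A₃ A₄ A₅ := by
  have hA0 : 0 ≤ A := le_trans (norm_nonneg _) (hA 0 0 (by norm_num))
  have hA₃0 : 0 ≤ A₃ := (norm_nonneg _).trans (hA₃ 0)
  have hA₄0 : 0 ≤ A₄ := (norm_nonneg _).trans (hA₄ 0)
  have hA₅0 : 0 ≤ A₅ := (norm_nonneg _).trans (hA₅ 0)
  have hG0 : 0 ≤ klCurveG5 A₃ A₄ := by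
    have : klCurveD1 ≤ klCurveG5 A₃ A₄ := by
      unfold klCurveG5; exact le_trans (le_trans (le_max_left _ _) (le_max_left _ _)) (le_max_left _ _)
    exact le_trans ((norm_nonneg _).trans (norm_iteratedDeriv_fermiPointLp_le_msD hA hA20 hd hlo hhi hA₃ hA₄ θ le_rfl (by norm_num))) this
  have hstep := abs_iteratedDeriv_frameRadius_le_step hA hA20 hd hlo hhi (n := 5) (by norm_num) θ
    (R := fun i : ℕ => match i with
        | 0 => π * Real.sqrt 2 | 1 => klCurveR1 | 2 => klCurveR2 | 3 => klCurveT3 A₃ | 4 => klCurveT4 A₃ A₄ | _ => 0)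
    (F := msD A₃ A₄) (Am := fun m : ℕ => match m with | 3 => A₃ | 4 => A₄ | 5 => A₅ | _ => A) (G := klCurveG5 A₃ A₄)
    (Emax := 4 + 1 / 20 + A₃ + A₄ + A₅) hG0 (by positivity)
    (fun i hi => abs_iteratedDeriv_frameRadius_le_table hA hA20 hd hlo hhi hA₃ hA₄ θ
      (R := fun i : ℕ => match i with
        | 0 => π * Real.sqrt 2 | 1 => klCurveR1 | 2 => klCurveR2 | 3 => klCurveT3 A₃ | 4 => klCurveT4 A₃ A₄ | _ => 0) rfl rfl rfl rfl rfl (by omega))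
    (fun i hi1 hi4 => norm_iteratedDeriv_fermiPointLp_le_msD hA hA20 hd hlo hhi hA₃ hA₄ θ hi1 (by omega))
    (fun i hi1 hi4 => (norm_nonneg _).trans (norm_iteratedDeriv_fermiPointLp_le_msD hA hA20 hd hlo hhi hA₃ hA₄ θ hi1 (by omega)))
    (fun i hi1 hi4 => msD_le_klCurveG5_pow hA hA20 hd hlo hhi hA₃ hA₄ θ hi1 (by omega))
    (fun m hm2 hm5 p => by
      interval_cases m
      · exact hA p 2 le_rfl
      · exact hA₃ p
      · exact hA₄ p
      · exact hA₅ p)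
    (fun m hm2 hm5 => by
      interval_cases m
      · show 4 + A ≤ 4 + 1 / 20 + A₃ + A₄ + A₅; linarith
      · show 4 + A₃ ≤ 4 + 1 / 20 + A₃ + A₄ + A₅; linarith
      · show 4 + A₄ ≤ 4 + 1 / 20 + A₃ + A₄ + A₅; linarith
      · show 4 + A₅ ≤ 4 + 1 / 20 + A₃ + A₄ + A₅; linarith)
  refine hstep.trans (le_of_eq ?_)
  norm_num [Finset.sum_range_succ, Finset.sum_range_zero, Nat.choose, Nat.factorial, klCurveT5, klCurveL5]

/-- **ORDER 5 of the frame's curve**: `‖∂⁵_ϑ toLp(k_F^K(ν;ϑ))‖ ≤ klCurveD5 A₃ A₄ A₅`. -/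
theorem norm_iteratedDeriv_five_fermiPointLp_le (θ : ℝ) :
    ‖iteratedDeriv 5 (fun t : ℝ => (WithLp.toLp 2 (klFermiPoint ν K t) : Momentum)) θ‖ ≤ klCurveD5 A₃ A₄ A₅ := by
  have h := norm_iteratedDeriv_fermiPointLp_le_of_radius hA hd hlo hhi (n := 5) θ
    (R := fun i : ℕ => match i with
        | 0 => π * Real.sqrt 2 | 1 => klCurveR1 | 2 => klCurveR2 | 3 => klCurveT3 A₃ | 4 => klCurveT4 A₃ A₄
        | 5 => klCurveT5 A₃ A₄ A₅ | _ => 0)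
    (fun i hi => by
      rcases Nat.lt_or_ge i 5 with hlt | hge
      · exact abs_iteratedDeriv_frameRadius_le_table hA hA20 hd hlo hhi hA₃ hA₄ θ
          (R := fun i : ℕ => match i with
            | 0 => π * Real.sqrt 2 | 1 => klCurveR1 | 2 => klCurveR2 | 3 => klCurveT3 A₃ | 4 => klCurveT4 A₃ A₄
            | 5 => klCurveT5 A₃ A₄ A₅ | _ => 0) rfl rfl rfl rfl rfl (by omega)
      · obtain rfl : i = 5 := le_antisymm hi hge
        exact abs_iteratedDeriv_five_frameRadius_le hA hA20 hd hlo hhi hA₃ hA₄ hA₅ θ)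
  refine h.trans (le_of_eq ?_)
  norm_num [Finset.sum_range_succ, Finset.sum_range_zero, Nat.choose, klCurveD5, klCurveL5]

include hA₆

/-- **ORDER 6 of the frame's Fermi radius**: `|u_K⁽⁶⁾(θ)| ≤ klCurveT6 A₃ A₄ A₅ A₆`. [cite: BenfattoGiulianiMastropietro2006, §2.4 Lemma 2.1 (2.40)] -/
theorem abs_iteratedDeriv_six_frameRadius_le (θ : ℝ) :
    |iteratedDeriv 6 (perturbedFermiRadius (fun p : Fin 2 → ℝ => -K.eval p) ν) θ| ≤ klCurveT6 A₃ A₄ A₅ A₆ := by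
  have hA0 : 0 ≤ A := le_trans (norm_nonneg _) (hA 0 0 (by norm_num))
  have hA₃0 : 0 ≤ A₃ := (norm_nonneg _).trans (hA₃ 0)
  have hA₄0 : 0 ≤ A₄ := (norm_nonneg _).trans (hA₄ 0)
  have hA₅0 : 0 ≤ A₅ := (norm_nonneg _).trans (hA₅ 0)
  have hA₆0 : 0 ≤ A₆ := (norm_nonneg _).trans (hA₆ 0)
  have hG50 : 0 ≤ klCurveG5 A₃ A₄ := by
    have : klCurveD1 ≤ klCurveG5 A₃ A₄ := by
      unfold klCurveG5; exact le_trans (le_trans (le_max_left _ _) (le_max_left _ _)) (le_max_left _ _)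
    exact le_trans ((norm_nonneg _).trans (norm_iteratedDeriv_fermiPointLp_le_msD hA hA20 hd hlo hhi hA₃ hA₄ θ le_rfl (by norm_num))) this
  have hG0 : 0 ≤ klCurveG6 A₃ A₄ A₅ := le_trans hG50 (le_max_left _ _)
  have hD50 : 0 ≤ klCurveD5 A₃ A₄ A₅ :=
    (norm_nonneg _).trans (norm_iteratedDeriv_five_fermiPointLp_le hA hA20 hd hlo hhi hA₃ hA₄ hA₅ θ)
  -- lower curve sizes against the order-6 geometric scale
  have hFG : ∀ i, 1 ≤ i → i ≤ 5 → msD6 A₃ A₄ A₅ A₆ i ≤ klCurveG6 A₃ A₄ A₅ ^ i := by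
    intro i hi1 hi5
    rcases Nat.lt_or_ge i 5 with hlt | hge
    · rw [msD6_eq_msD _ _ _ _ (by omega)]
      exact (msD_le_klCurveG5_pow hA hA20 hd hlo hhi hA₃ hA₄ θ hi1 (by omega)).trans
        (pow_le_pow_left₀ hG50 (le_max_left _ _) i)
    · obtain rfl : i = 5 := le_antisymm hi5 hge
      have hr : (klCurveD5 A₃ A₄ A₅ ^ ((5 : ℝ)⁻¹)) ^ 5 = klCurveD5 A₃ A₄ A₅ := by
        have := Real.rpow_inv_natCast_pow hD50 (n := 5) (by norm_num); simp only [Nat.cast_ofNat] at this; exact this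
      calc msD6 A₃ A₄ A₅ A₆ 5 = (klCurveD5 A₃ A₄ A₅ ^ ((5 : ℝ)⁻¹)) ^ 5 := by rw [msD6_five, hr]
        _ ≤ klCurveG6 A₃ A₄ A₅ ^ 5 := pow_le_pow_left₀ (by positivity) (le_max_right _ _) 5
  have hstep := abs_iteratedDeriv_frameRadius_le_step hA hA20 hd hlo hhi (n := 6) (by norm_num) θ
    (R := fun i : ℕ => match i with
        | 0 => π * Real.sqrt 2 | 1 => klCurveR1 | 2 => klCurveR2 | 3 => klCurveT3 A₃ | 4 => klCurveT4 A₃ A₄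
        | 5 => klCurveT5 A₃ A₄ A₅ | _ => 0)
    (F := msD6 A₃ A₄ A₅ A₆) (Am := fun m : ℕ => match m with | 3 => A₃ | 4 => A₄ | 5 => A₅ | 6 => A₆ | _ => A)
    (G := klCurveG6 A₃ A₄ A₅) (Emax := 4 + 1 / 20 + A₃ + A₄ + A₅ + A₆) hG0 (by positivity)
    (fun i hi => by
      rcases Nat.lt_or_ge i 5 with hlt | hge
      · exact abs_iteratedDeriv_frameRadius_le_table hA hA20 hd hlo hhi hA₃ hA₄ θ
          (R := fun i : ℕ => match i with
            | 0 => π * Real.sqrt 2 | 1 => klCurveR1 | 2 => klCurveR2 | 3 => klCurveT3 A₃ | 4 => klCurveT4 A₃ A₄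
            | 5 => klCurveT5 A₃ A₄ A₅ | _ => 0) rfl rfl rfl rfl rfl (by omega)
      · obtain rfl : i = 5 := by omega
        exact abs_iteratedDeriv_five_frameRadius_le hA hA20 hd hlo hhi hA₃ hA₄ hA₅ θ)
    (fun i hi1 hi5 => by
      rcases Nat.lt_or_ge i 5 with hlt | hge
      · rw [msD6_eq_msD _ _ _ _ (by omega)]
        exact norm_iteratedDeriv_fermiPointLp_le_msD hA hA20 hd hlo hhi hA₃ hA₄ θ hi1 (by omega)
      · obtain rfl : i = 5 := by omega
        rw [msD6_five]; exact norm_iteratedDeriv_five_fermiPointLp_le hA hA20 hd hlo hhi hA₃ hA₄ hA₅ θ)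
    (fun i hi1 hi5 => by
      rcases Nat.lt_or_ge i 5 with hlt | hge
      · rw [msD6_eq_msD _ _ _ _ (by omega)]
        exact (norm_nonneg _).trans (norm_iteratedDeriv_fermiPointLp_le_msD hA hA20 hd hlo hhi hA₃ hA₄ θ hi1 (by omega))
      · obtain rfl : i = 5 := by omega
        rw [msD6_five]; exact hD50)
    (fun i hi1 hi5 => hFG i hi1 (by omega))
    (fun m hm2 hm6 p => by
      interval_cases m
      · exact hA p 2 le_rfl
      · exact hA₃ p
      · exact hA₄ p
      · exact hA₅ p
      · exact hA₆ p)
    (fun m hm2 hm6 => by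
      interval_cases m
      · show 4 + A ≤ 4 + 1 / 20 + A₃ + A₄ + A₅ + A₆; linarith
      · show 4 + A₃ ≤ 4 + 1 / 20 + A₃ + A₄ + A₅ + A₆; linarith
      · show 4 + A₄ ≤ 4 + 1 / 20 + A₃ + A₄ + A₅ + A₆; linarith
      · show 4 + A₅ ≤ 4 + 1 / 20 + A₃ + A₄ + A₅ + A₆; linarith
      · show 4 + A₆ ≤ 4 + 1 / 20 + A₃ + A₄ + A₅ + A₆; linarith)
  refine hstep.trans (le_of_eq ?_)
  norm_num [Finset.sum_range_succ, Finset.sum_range_zero, Nat.choose, Nat.factorial, klCurveT6, klCurveL6]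

/-- **ORDER 6 of the frame's curve**: `‖∂⁶_ϑ toLp(k_F^K(ν;ϑ))‖ ≤ klCurveD6 A₃ A₄ A₅ A₆`. -/
theorem norm_iteratedDeriv_six_fermiPointLp_le (θ : ℝ) :
    ‖iteratedDeriv 6 (fun t : ℝ => (WithLp.toLp 2 (klFermiPoint ν K t) : Momentum)) θ‖ ≤ klCurveD6 A₃ A₄ A₅ A₆ := by
  have h := norm_iteratedDeriv_fermiPointLp_le_of_radius hA hd hlo hhi (n := 6) θ
    (R := fun i : ℕ => match i with
        | 0 => π * Real.sqrt 2 | 1 => klCurveR1 | 2 => klCurveR2 | 3 => klCurveT3 A₃ | 4 => klCurveT4 A₃ A₄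
        | 5 => klCurveT5 A₃ A₄ A₅ | _ => klCurveT6 A₃ A₄ A₅ A₆)
    (fun i hi => by
      rcases Nat.lt_or_ge i 5 with hlt | hge
      · exact abs_iteratedDeriv_frameRadius_le_table hA hA20 hd hlo hhi hA₃ hA₄ θ
          (R := fun i : ℕ => match i with
            | 0 => π * Real.sqrt 2 | 1 => klCurveR1 | 2 => klCurveR2 | 3 => klCurveT3 A₃ | 4 => klCurveT4 A₃ A₄
            | 5 => klCurveT5 A₃ A₄ A₅ | _ => klCurveT6 A₃ A₄ A₅ A₆) rfl rfl rfl rfl rfl (by omega)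
      · rcases Nat.lt_or_ge i 6 with hlt6 | hge6
        · obtain rfl : i = 5 := by omega
          exact abs_iteratedDeriv_five_frameRadius_le hA hA20 hd hlo hhi hA₃ hA₄ hA₅ θ
        · obtain rfl : i = 6 := le_antisymm hi hge6
          exact abs_iteratedDeriv_six_frameRadius_le hA hA20 hd hlo hhi hA₃ hA₄ hA₅ hA₆ θ)
  refine h.trans (le_of_eq ?_)
  norm_num [Finset.sum_range_succ, Finset.sum_range_zero, Nat.choose, klCurveD6, klCurveL6]

/-- **THE CURVE TOWER TO ORDER SIX** (the `iteratedDeriv` key): `‖∂ⁱ_ϑ toLp(k_F^K(ν;ϑ))‖ ≤ msD6 A₃ A₄ A₅ A₆ i` for `1 ≤ i ≤ 6` — orders `≤ 4` are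
the landed `fermiPointLp_sizes_of_sizes`, orders 5, 6 the generic level tower. [cite: BenfattoGiulianiMastropietro2006, §2.4 Lemma 2.1 (2.40)] -/
theorem norm_iteratedDeriv_fermiPointLp_le_msD6 (θ : ℝ) {i : ℕ} (hi1 : 1 ≤ i) (hi6 : i ≤ 6) :
    ‖iteratedDeriv i (fun t : ℝ => (WithLp.toLp 2 (klFermiPoint ν K t) : Momentum)) θ‖ ≤ msD6 A₃ A₄ A₅ A₆ i := by
  rcases Nat.lt_or_ge i 5 with hlt | hge
  · rw [msD6_eq_msD _ _ _ _ (by omega)]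
    exact norm_iteratedDeriv_fermiPointLp_le_msD hA hA20 hd hlo hhi hA₃ hA₄ θ hi1 (by omega)
  · rcases Nat.lt_or_ge i 6 with hlt6 | hge6
    · obtain rfl : i = 5 := by omega
      rw [msD6_five]; exact norm_iteratedDeriv_five_fermiPointLp_le hA hA20 hd hlo hhi hA₃ hA₄ hA₅ θ
    · obtain rfl : i = 6 := le_antisymm hi6 hge6
      rw [msD6_six]; exact norm_iteratedDeriv_six_fermiPointLp_le hA hA20 hd hlo hhi hA₃ hA₄ hA₅ hA₆ θ

/-- The same in the `iteratedFDeriv` key of `fermiPointLp_sizes_of_sizes`: `γ_K ∈ C⁶` and `‖Dⁱγ_K(θ)‖ ≤ msD6 … i` (`1 ≤ i ≤ 6`). -/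
theorem fermiPointLp_sizes_of_sizes_six (θ : ℝ) :
    ContDiff ℝ 6 (fun t : ℝ => (WithLp.toLp 2 (klFermiPoint ν K t) : Momentum)) ∧
    ∀ i, 1 ≤ i → i ≤ 6 → ‖iteratedFDeriv ℝ i (fun t : ℝ => (WithLp.toLp 2 (klFermiPoint ν K t) : Momentum)) θ‖ ≤ msD6 A₃ A₄ A₅ A₆ i := by
  set B := bandBounds (show (-4 : ℝ) < -1.1 by norm_num) (show (-1.1 : ℝ) ≤ -0.1 by norm_num) (show (-0.1 : ℝ) < 0 by norm_num)
    with hBdef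
  have hADt : 2 * A < B.Dtmin := by have := klCurveD_pos; linarith
  refine ⟨((EuclideanSpace.equiv (Fin 2) ℝ).symm : (Fin 2 → ℝ) →L[ℝ] Momentum).contDiff.comp
    (PerturbedFermiCurve.contDiff_klFermiPoint B hA hADt hlo hhi (m := 6)), fun i hi1 hi6 => ?_⟩
  rw [norm_iteratedFDeriv_eq_norm_iteratedDeriv]
  exact norm_iteratedDeriv_fermiPointLp_le_msD6 hA hA20 hd hlo hhi hA₃ hA₄ hA₅ hA₆ θ hi1 hi6

end Sizes

end Summit.HubbardSuperconductivity.HubbardSuperconductivity.Theorems.PerturbedFermiCurve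

end
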